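import Mathlib.AlgebraicGeometry.Group.Abelian
import Literature.AlgebraicGeometry.Motives.Varieties
import Literature.AlgebraicGeometry.Motives.AlgPoints
import Literature.AlgebraicGeometry.Motives.AbelianVariety
import Literature.AlgebraicGeometry.Motives.Cycles
import Literature.AlgebraicGeometry.Motives.HodgeWave0
import HarnessLib

-- provenance: harness21/H21/H21/Statements/Hodge/CyclesAbelianVarieties.lean @ 18f4f3b (interim HEAD d8f2665); M5 mechanical rewrite
/-!
# Hodge family: Chow groups and abelian varieties (items hodge.S10, hodge.S35)

Family `hodge`, trunk MotiveAbstract, work item `HodgeCyclesAbelian`.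

## Covered statement ids

* **hodge.S10** (definition-statement; Fulton, *Intersection Theory* §§1.3–1.4, dimension-graded
  as in `Literature.Prelude.MotiveAbstract.Cycles`): algebraic cycles `Z_d X = Literature.cyclesOfDim`,
  rational equivalence `Literature.AlgebraicGeometry.Motives.IsRationallyEquivalent`, Chow groups `CH_d X = Literature.ChowGroup X d`
  and proper push-forward `Literature.AlgebraicGeometry.Motives.ChowGroup.pushforward` are *defined* in the prelude; here we
  record the sanity statements the inventory item asks for (namespace `Literature.Hodge`):
  `chowGroup_mk_eq_mk_iff` (classes agree iff rationally equivalent; real proof),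
  `chowGroup_pushforward_comp` (functoriality of proper push-forward for proper maps of
  `k`-schemes locally of finite type; reduces to the prelude theorem, whose proof is deferred;
  the properness of the composite is discharged here rather than assumed),
  `nonempty_chowGroup_top_equiv_int` (`CH_n X ≅ ℤ` for a smooth projective `n`-fold; sorry) and
  its strengthening `exists_chowGroup_top_equiv_int` (the isomorphism sends the fundamental
  class — the class of any, hence the unique, `n`-dimensional point — to `1`; sorry), and
  `divFun_mem_cyclesOfDim_of_isSmoothProjective` (`div f` is a `d`-cycle on a smooth projective
  variety; reduces to the prelude theorem).
  **Missing clause:** flat pull-back `f^* : CH_d Y → CH_{d + r} X` (Fulton §1.7) is *not*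
  defined — it needs lengths of scheme-theoretic fibres, absent from Mathlib v4.32.0 — and is the
  recorded gap of hodge.S10.
* **hodge.S35**, projectivity clause (Mumford, *Abelian Varieties* §6, Application 1, p. 62;
  §7 over an arbitrary field): `Literature.AlgebraicGeometry.Motives.AbelianVariety.isProjectiveOver`. This was "not statable" in
  wave 0 (no projective morphisms in Mathlib); it is now stated through
  `Literature.AlgebraicGeometry.Motives.IsProjectiveOver` (closed `k`-immersion into some `ℙⁿ_k`). We also bridge the wave-0
  predicate `Literature.AlgebraicGeometry.Motives.IsAbelianVariety` with the bundled `Literature.AlgebraicGeometry.Motives.AbelianVariety`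
  (`Literature.AlgebraicGeometry.Motives.AbelianVariety.isAbelianVariety`, `Literature.AlgebraicGeometry.Motives.AbelianVariety.ofIsAbelianVariety`, both real, glue
  without statement id) and restate the count of torsion points over `AlgebraicClosure k`
  (`Literature.AlgebraicGeometry.Motives.AbelianVariety.natCard_torsionPoints`).
  The commutativity clause of hodge.S35 is *not* restated: it is the prelude instance
  `Literature.AlgebraicGeometry.Motives.AbelianVariety.instIsCommMonObj` (bundled form) and wave 0's
  `Literature.AlgebraicGeometry.Motives.IsAbelianVariety.isCommMonObj` (predicate form), both Mathlib's
  `AlgebraicGeometry.isCommMonObj_of_isProper_of_geometricallyIntegral`.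

## Namespaces

The hodge.S10 statements live in `Literature.Hodge`. The hodge.S35 declarations are dot-notation API on
the prelude structure `Literature.AlgebraicGeometry.Motives.AbelianVariety`, so they are declared (from inside `Literature.Hodge`, via
`_root_`) in the namespace `Literature.AlgebraicGeometry.Motives.AbelianVariety`, following the library pattern
(`Statements/Turb/Onsager.lean`); e.g. `A.isProjectiveOver` works for `A : Literature.AbelianVariety k`.

## Mathlib search

Mathlib has `AlgebraicCycle`, `AlgebraicCycle.map`, `Scheme.ord`, `IsProper`,
`GeometricallyIntegral`, `GrpObj`, `isCommMonObj_of_isProper_of_geometricallyIntegral`,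
`AlgebraicClosure`, `IsAlgClosed`; it has no Chow groups, no rational equivalence, no bundled
abelian varieties and no projective morphisms (searched `ChowGroup`, `rationalEquiv`,
`AbelianVariety`, `IsProjective` in `Mathlib/AlgebraicGeometry`). Nothing is added to Mathlib's
namespaces.
-/

universe u

open CategoryTheory AlgebraicGeometry

noncomputable section

namespace Literature.AlgebraicGeometry.Motives

variable {k : Type u} [Field k]

/-! ## hodge.S10: cycles, rational equivalence, Chow groups, proper push-forward -/

section Chow

/-- **hodge.S10** (rational equivalence; Fulton, *Intersection Theory* §1.3; Stacks 02S0).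
Two `d`-cycles on a scheme `X` have the same class in the Chow group `CH_d X = Z_d X / Rat_d X`
if and only if they are rationally equivalent, i.e. their difference lies in the subgroup
generated by the divisors `[div f]` of nonzero rational functions on `(d + 1)`-dimensional closed
subvarieties. Real proof (`Literature.AlgebraicGeometry.Motives.ChowGroup.mk_eq_mk_iff`). [folklore] -/
theorem chowGroup_mk_eq_mk_iff {X : Scheme.{u}} {d : ℕ} {c c' : ↥(cyclesOfDim X d)} :
    ChowGroup.mk X d c = ChowGroup.mk X d c' ↔
      IsRationallyEquivalent (c : AlgebraicCycle X ℤ) c' d :=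
  ChowGroup.mk_eq_mk_iff

/-- **hodge.S10** (functoriality of proper push-forward; Fulton, *Intersection Theory* §1.4,
p. 11–12; Stacks 02R7). For proper morphisms `f : X → Y`, `g : Y → Z` of schemes locally of
finite type over a field `k`, `(g ∘ f)_* = g_* ∘ f_* : CH_d X → CH_d Z`. Reduces to the prelude
theorem `Literature.AlgebraicGeometry.Motives.ChowGroup.pushforward_comp` (whose proof is deferred). Unlike the prelude
signature, properness of the composite `(f ≫ g).left = f.left ≫ g.left` is discharged in the
statement (Mathlib instance `IsProper` for compositions) rather than assumed.  The prelude's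
named facts `Literature.AlgebraicGeometry.Motives.map_mem_ratTrivial` (Fulton Thm 1.4, through which `ChowGroup.pushforward` is
defined) and `Literature.AlgebraicGeometry.Motives.ChowGroup.pushforward_comp` are the explicit hypotheses `h`, `hcomp`. [folklore] -/
theorem chowGroup_pushforward_comp (d : ℕ) (h : map_mem_ratTrivial d (k := k))
    (hcomp : ChowGroup.pushforward_comp d (k := k)) {X Y Z : SchemeOver k} (f : X ⟶ Y)
    (g : Y ⟶ Z) [IsProper f.left] [IsProper g.left] [LocallyOfFiniteType X.hom]
    [LocallyOfFiniteType Y.hom] [LocallyOfFiniteType Z.hom] :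
    haveI : IsProper (f ≫ g).left := inferInstanceAs (IsProper (f.left ≫ g.left))
    ChowGroup.pushforward d h (f ≫ g) =
      (ChowGroup.pushforward d h g).comp (ChowGroup.pushforward d h f) :=
  haveI : IsProper (f ≫ g).left := inferInstanceAs (IsProper (f.left ≫ g.left))
  hcomp h f g

/-- **hodge.S10** (fundamental class; Fulton, *Intersection Theory* §1.3 and Example 1.3.2, §1.5).
For a smooth projective (geometrically integral) variety `X` of dimension `n` over a field, the
top Chow group `CH_n X = Z_n X` is infinite cyclic: `CH_n X ≅ ℤ`. See
`exists_chowGroup_top_equiv_int` for the normalisation by the fundamental class. [cite: Fulton1998, §1.3 and Example 1.3.2] -/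
def nonempty_chowGroup_top_equiv_int : Prop :=
  ∀ {n : ℕ} {X : SchemeOver k}, IsSmoothProjective n X → Nonempty (ChowGroup X.left n ≃+ ℤ)

/-- **hodge.S10** (fundamental class generates the top Chow group; Fulton, *Intersection Theory*
§1.3, Example 1.3.2, §1.5). For a smooth projective (geometrically integral) variety `X` of
dimension `n` over a field there is an isomorphism `CH_n X ≃+ ℤ` sending the class `[V]` of every
`n`-dimensional closed integral subscheme `V` — necessarily `V = X`, i.e. the fundamental class
`[X]`, since `X` is irreducible of dimension `n` — to `1`. [cite: Fulton1998, §1.3 and Example 1.3.2] -/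
def exists_chowGroup_top_equiv_int : Prop :=
  ∀ {n : ℕ} {X : SchemeOver k}, IsSmoothProjective n X →
    ∃ e : ChowGroup X.left n ≃+ ℤ,
      ∀ (z : ↥X.left) (hz : Order.height z = n), e (ChowGroup.ofPoint z hz) = 1

/-- **hodge.S10** (principal divisors are cycles; Fulton, *Intersection Theory* §§1.2–1.3;
Stacks 02JU, 0A21). On a smooth projective variety `X` over a field, for a closed subvariety
`W ⊆ X` of dimension `d + 1` and a nonzero rational function `f ∈ K(W)`, the principal divisor
`[div f]` is a `d`-cycle on `X`. This is `Literature.AlgebraicGeometry.Motives.divFun_mem_cyclesOfDim` (stated for schemes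
locally of finite type over `k`, a named fact there, taken as the explicit hypothesis `h`)
specialised via smooth ⇒ locally of finite presentation ⇒ locally of finite type (Mathlib
instances). [folklore] -/
theorem divFun_mem_cyclesOfDim_of_isSmoothProjective (h : divFun_mem_cyclesOfDim.{u}) {n : ℕ}
    {X : SchemeOver k} (hX : IsSmoothProjective n X) (W : ClosedSubvariety X.left)
    [IsLocallyNoetherian W.carrier] {d : ℕ} {f : W.carrier.functionField} (hW : W.dim = d + 1)
    (hf : f ≠ 0) (c : AlgebraicCycle X.left ℤ) (hc : ⇑c = W.divFun f) :
    c ∈ cyclesOfDim X.left d := by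
  haveI := hX.smoothOfRelativeDimension
  haveI : Smooth X.hom := SmoothOfRelativeDimension.smooth n X.hom
  exact h X W hW hf c hc

end Chow

/-! ## hodge.S35: abelian varieties are projective; bridge with wave 0

Declared in the namespace `Literature.AlgebraicGeometry.Motives.AbelianVariety` (dot notation on the prelude structure). -/

section Abelian

/-- **hodge.S35** (abelian varieties are projective; Mumford, *Abelian Varieties* §6,
Application 1, p. 62, and §7 for an arbitrary base field; Milne, *Abelian Varieties* Thm 7.1).
The underlying `k`-scheme of an abelian variety admits a closed `k`-immersion into some
projective space `ℙⁿ_k`. (In wave 0 this clause was not statable; it is the projectivity field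
of the prelude theorem `Literature.AlgebraicGeometry.Motives.AbelianVariety.isSmoothProjective`, whose proof is deferred.) [folklore] -/
def AbelianVariety.isProjectiveOver : Prop :=
  ∀ (A : AbelianVariety k),
    IsProjectiveOver A.X

/- interim proof relied on results that are now named facts (D-0014); demoted to a fact by the M5 import, proof preserved:
:=
  A.isSmoothProjective.isProjectiveOver
-/

/-- Bridge, bundled ⇒ predicate (Mumford, *Abelian Varieties* §4, Definition). The underlying
group scheme of a bundled abelian variety `A : Literature.AbelianVariety k` satisfies the wave-0
predicate `Literature.AlgebraicGeometry.Motives.IsAbelianVariety` (proper and geometrically integral). Real proof. [folklore] -/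
theorem AbelianVariety.isAbelianVariety (A : AbelianVariety k) :
    IsAbelianVariety A.X :=
  ⟨A.isProper, A.geometricallyIntegral⟩

/-- Bridge, predicate ⇒ bundled (Mumford, *Abelian Varieties* §4, Definition). A `k`-group
scheme `G` satisfying the wave-0 predicate `Literature.AlgebraicGeometry.Motives.IsAbelianVariety` bundles into an
`Literature.AbelianVariety k`. Real definition. [folklore] -/
def AbelianVariety.ofIsAbelianVariety (G : SchemeOver k) [GrpObj G]
    (h : IsAbelianVariety G) : AbelianVariety k where
  X := G
  isProper := h.isProper
  geometricallyIntegral := h.geometricallyIntegral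

/-- The underlying `k`-scheme of `AbelianVariety.ofIsAbelianVariety G h` is `G`
(Mumford, *Abelian Varieties* §4). [folklore] -/
@[simp]
theorem AbelianVariety.ofIsAbelianVariety_X (G : SchemeOver k) [GrpObj G]
    (h : IsAbelianVariety G) : (AbelianVariety.ofIsAbelianVariety G h).X = G :=
  rfl

/-- The predicate recovered from the bundled abelian variety built from it
(Mumford, *Abelian Varieties* §4). [folklore] -/
theorem AbelianVariety.isAbelianVariety_ofIsAbelianVariety (G : SchemeOver k)
    [GrpObj G] (h : IsAbelianVariety G) :
    IsAbelianVariety (AbelianVariety.ofIsAbelianVariety G h).X :=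
  h

/-- Round trip bundled ⇒ predicate ⇒ bundled is the identity
(Mumford, *Abelian Varieties* §4). [folklore] -/
@[simp]
theorem AbelianVariety.ofIsAbelianVariety_isAbelianVariety (A : AbelianVariety k) :
    AbelianVariety.ofIsAbelianVariety A.X A.isAbelianVariety = A :=
  rfl

/-- **hodge.S35** (torsion points over the algebraic closure; Mumford, *Abelian Varieties* §6,
Application 3 and Proposition p. 64; Appendix to §7 in characteristic `p ∤ n`). For an abelian
variety `A` of dimension `g` over `k` and `n` invertible in `k`, `A[n](k̄)` has exactly `n^{2g}`
points, where `k̄ = AlgebraicClosure k`. Reduces to the prelude theorem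
`Literature.AlgebraicGeometry.Motives.AbelianVariety.natCard_torsionPoints_of_isAlgClosed` (proof deferred there). [folklore] -/
def AbelianVariety.natCard_torsionPoints : Prop :=
  ∀ (A : AbelianVariety k) (n : ℤ), (n : k) ≠ 0 →
    Nat.card (A.torsionPoints (AlgebraicClosure k) n) = n.natAbs ^ (2 * A.dim)

/- interim proof relied on results that are now named facts (D-0014); demoted to a fact by the M5 import, proof preserved:
:=
  A.natCard_torsionPoints_of_isAlgClosed (AlgebraicClosure k) n hn
-/

end Abelian

/-- Sanity check: the hodge.S35 clause (now a named fact) specialises to any `A`. -/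
example (h : AbelianVariety.isProjectiveOver (k := k)) (A : AbelianVariety k) :
    IsProjectiveOver A.X := h A

end Literature.AlgebraicGeometry.Motives

end
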